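import Summits.ResolutionOfSingularities.ResolutionOfSingularities.Theorems.FrobeniusLadderFRationalResolutionSingBlowupInduction
import Summits.ResolutionOfSingularities.ResolutionOfSingularities.Theorems.FrobeniusLadderFRationalResolutionBaseChartAlgebra
import HarnessLib

/-!
# Crux `FrobeniusLadder.FRationalResolution` (stmt-ResolutionOfSingularities-15317), line `redirect`,
# stub `stub_diagonalizableQuotientResolution` — **ENTRY of design C3 (round 0): varieties whose singular points carry
# sharp rank-two log regular charts along strata of any dimension are resolved by iterating `Bl_{𝓘_{Sing}}`**
# (the rank-2 stratum layer of the non-isolated case, over every field, in every dimension)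

**`hasResolution_of_rank_two_charts`.** Let `X` be integral, locally of finite type over a field `k`, and suppose that
every SINGULAR point `x` has an étale roof `X ←ρ— Y —j↪ Spec A` into a Noetherian ring carrying an fs (finitely
generated, saturated, spanning) chart `φ : P → A`, `P ⊆ ℤ²`, in normal form `{m u + l e : l ≥ 0, a l ≤ d m}` with
`a < d ≤ D`, such that `x ↦ 𝔭` with ALL non-trivial monomials in `𝔭` (unit face `0`), `φ` is Kato-log-regular at every
prime below a point of the roof, and on the roof the singular locus is the fixed stratum: `¬ regular A_{j y'} ↔
I(𝔭, φ) ⊆ j y'`. Then `X` has a resolution of singularities — the iterated blowing up of the reduced singular locus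
(`…SingBlowupInduction.hasResolution_of_invariant`, entered with the base chart as a chart algebra over itself,
`…BaseChartAlgebra`). Typical instance: `X` étale-locally `(two-dimensional toric cone) × (regular)`, e.g. products and
twisted forms of rational double points `A_n` along arbitrary singular strata, over imperfect fields included.

Honest label: assembly toward ONE leaf stub (no stub, crux or summit closed); what it does NOT do: produce these charts
from the stub's hypothesis `hq` (that is lineage 2/4's chart normalisation + `…FixedStratumEntry`, and the pointwise
description of the singular locus of the base chart). No definitions, no named facts, no sorry.
[cite: Kato1994, Def. (2.1), (7.3), (10.1), (10.3)] [cite: KempfEtAl1973, Ch. I §2] [cite: Liu2002, §8.3.4, (3.11)]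
-/

noncomputable section

-- single-problem summit: the doubled namespace component is forced
set_option linter.dupNamespace false

open CategoryTheory CategoryTheory.Limits AlgebraicGeometry TopologicalSpace
open IsLocalRing Literature.AlgebraicGeometry.Resolution Literature.AlgebraicGeometry.Resolution.LogChart
open Summit.ResolutionOfSingularities.ResolutionOfSingularities.Theorems.FRationalResolution

namespace Summit.ResolutionOfSingularities.ResolutionOfSingularities.Theorems.FRationalResolution.SingBlowupEntry

set_option maxHeartbeats 800000 in
/-- **Varieties with sharp rank-two log regular charts at their singular points (strata of any dimension, any field)
are resolved by iterating the blowing up of the reduced singular locus.** See the module docstring.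
[cite: Kato1994, Def. (2.1), (7.3), (10.1), (10.3)] [cite: KempfEtAl1973, Ch. I §2] -/
theorem hasResolution_of_rank_two_charts (D : ℕ) {k : Type} [Field k] (X : Scheme.{0}) [IsIntegral X]
    (f : X ⟶ Spec (.of k)) [LocallyOfFiniteType f]
    (H : ∀ x : X, x ∉ Scheme.regularLocus X →
      ∃ (A : Type) (_ : CommRing A) (_ : IsNoetherianRing A) (P : AddSubmonoid (Fin 2 → ℤ))
          (φ : Multiplicative P →* A) (𝔭 : Ideal A) (_ : 𝔭.IsPrime) (u e : Fin 2 → ℤ) (a d : ℕ),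
          a < d ∧ d ≤ D ∧ P.FG ∧
          (∀ (w : Fin 2 → ℤ) (k : ℕ), 0 < k → k • w ∈ P → w ∈ P) ∧
          Submodule.span ℤ (P : Set (Fin 2 → ℤ)) = ⊤ ∧
          (∀ p : P, (p : Fin 2 → ℤ) ≠ 0 → φ (Multiplicative.ofAdd p) ∈ 𝔭) ∧
          (∀ w, w ∈ P ↔ ∃ g ∈ Submodule.span ℤ (faceMonoid P φ 𝔭 : Set (Fin 2 → ℤ)), ∃ m l : ℤ,
            0 ≤ l ∧ (a : ℤ) * l ≤ (d : ℤ) * m ∧ w = g + m • u + l • e) ∧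
          (∀ g ∈ Submodule.span ℤ (faceMonoid P φ 𝔭 : Set (Fin 2 → ℤ)), ∀ m l : ℤ,
            g + m • u + l • e = 0 → m = 0 ∧ l = 0) ∧
          (∀ w : Fin 2 → ℤ, ∃ g ∈ Submodule.span ℤ (faceMonoid P φ 𝔭 : Set (Fin 2 → ℤ)),
            ∃ m l : ℤ, w = g + m • u + l • e) ∧
          ∃ (Y : Scheme.{0}) (ρ : Y ⟶ X) (_ : Etale ρ) (j : Y ⟶ Spec (.of A)) (_ : IsOpenImmersion j) (y : Y),
            ρ y = x ∧ (j y).asIdeal = 𝔭 ∧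
            (∀ y' : Y, ¬ IsRegularLocalRing (Localization.AtPrime (j y').asIdeal) ↔ ideal P φ 𝔭 ≤ (j y').asIdeal) ∧
            (∀ (y' : Y) (𝔮 : Ideal A) [𝔮.IsPrime], 𝔮 ≤ (j y').asIdeal → IsLogRegularAt P φ 𝔮)) :
    Scheme.HasResolution X := by
  refine SingBlowupInduction.hasResolution_of_invariant D X f fun x hx => ?_
  obtain ⟨A, _, _, P, φ, 𝔭, _, u, e, a, d, had, hdD, hP, hsat, hspanP, hface, hQ, hind, hspan, Y, ρ, _, j, _, y,
    hρy, hjy, hSing, hregY⟩ := H x hx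
  have hreg : IsLogRegularAt P φ 𝔭 := hregY y 𝔭 (by rw [hjy])
  have hq𝔭 : ∀ q : P, (q : Fin 2 → ℤ) ∉ Submodule.span ℤ (faceMonoid P φ 𝔭 : Set (Fin 2 → ℤ)) →
      φ (Multiplicative.ofAdd q) ∈ 𝔭 := by
    intro q hq
    apply hface q
    intro h0
    apply hq
    rw [h0]
    exact Submodule.zero_mem _
  have hunit : ∀ (I : Ideal A) [I.IsPrime], ∀ w ∈ faceMonoid P φ 𝔭, val P φ w ∉ I := by
    intro I _ w hw
    obtain ⟨hwP, hw𝔭⟩ := (mem_faceMonoid P φ 𝔭).1 hw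
    have hw0 : w = 0 := by
      by_contra hne
      apply hw𝔭
      rw [val_of_mem P φ hwP]
      exact hface ⟨w, hwP⟩ hne
    subst hw0
    rw [val_zero]
    exact fun h1 => (Ideal.IsPrime.ne_top inferInstance) (Ideal.eq_top_of_isUnit_mem _ h1 isUnit_one)
  refine ⟨A, inferInstance, inferInstance, 2, P, φ, 𝔭, inferInstance, A, inferInstance, inferInstance, inferInstance,
    P, φ, u, e, a, d, had, hdD, hP, hsat, hspanP, hreg, le_refl P, BaseChartAlgebra.self_chi,
    BaseChartAlgebra.self_adjoin_eq_top, BaseChartAlgebra.self_denominators, BaseChartAlgebra.self_kernel,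
    BaseChartAlgebra.self_fieldExtension, hP, hQ, hind, hspan, fun 𝔮 _ h𝔮 _ => hregY y 𝔮 (by rw [hjy]; exact h𝔮),
    by omega, 𝔭, inferInstance, (by ext t; rw [Ideal.mem_comap]; exact Iff.rfl), hq𝔭, Y, ρ, inferInstance, j, inferInstance, y, hρy, hjy, hSing,
    fun y' w hw => hunit _ w hw, fun y' 𝔮 _ h𝔮 => hregY y' 𝔮 ?_⟩
  intro t ht
  have h1 := h𝔮 ht
  rw [Ideal.mem_comap] at h1
  exact h1

end Summit.ResolutionOfSingularities.ResolutionOfSingularities.Theorems.FRationalResolution.SingBlowupEntry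

end
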